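import Summits.ABC.ABC.Theorems.IneffectiveSubspaceUniformSadicTowerFourOnePrimeOfLevelOne

/-!
# `UniformSadicTowerFour` (stmt-ABC-14937), line `flat-steep-split` (lead c4): the ONE-LOG corner of
# UPD(1,2) — large square divisors of `r^d − 1`, and of the cyclotomic value `Φ₅(r)`, at primes are small

Lead c4's normal form of the first open rung `W = 3` of the crux's necessary condition BoundedOmegaABC
is the ONE-PRIME / TWO-BASE divisibility bound **UPD(1,2)**: for every `ε > 0` there is `C` such that
for all distinct primes `p, q, r` and all `Y, Z, t ∈ ℕ`

* if `p^t ∣ q^Y r^Z − 1` (and `q^Y r^Z ≥ 2`), or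
* if `p^t ∣ r^Z − q^Y` (and `q^Y < r^Z`),

then `p^t ≤ C · (pqr)^(1+ε) · (q^Y r^Z)^ε`.  The crux `UniformSadicTowerFour` implies UPD(1,2)
(`onePrimeTwoBase_of_uniformSadicTowerFour`, sibling file `…OnePrimeOfLevelOne.lean`).  UPD(1,2) is
inlined verbatim as the hypothesis `hU` (no definition); it is an abc-type statement and is OPEN.

This file isolates the ONE-LOGARITHM corner `Y = 0` of UPD(1,2) — a single base `r`, the `p`-part of
`r^d − 1` — in its simplest non-trivial instance, SQUARE prime divisors:

* `squareDivisor_pow_sub_one_of_onePrimeTwoBase` — UPD(1,2) ⟹ for every fixed `d ≥ 1` and `δ > 0`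
  there is `C = C(d, δ)` with `p ≤ C · r^(1+δ)` whenever `p ≠ r` are primes and `p² ∣ r^d − 1`;
* `squareDivisor_cyclotomicFive_of_onePrimeTwoBase` — UPD(1,2) ⟹ the same bound for square prime
  divisors `p² ∣ Φ₅(r) = r⁴ + r³ + r² + r + 1` of the fifth cyclotomic value at a prime `r`;
* `squareDivisor_cyclotomicFive_of_uniformSadicTowerFour` — hence the crux implies it.

**Proofs.** (1) Fix `d ≥ 1`, `δ > 0` and put `ε := min(1/2, δ / (2(d+2)))`, so that
`(1 + ε + dε)/(1 − ε) ≤ 1 + δ` (i.e. `2ε + dε + δε ≤ δ`).  Take the constant `C = C(ε)` of UPD.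
Given primes `p ≠ r` with `p² ∣ r^d − 1`, pick an auxiliary prime `q ∈ {2, 3, 5}` distinct from
`p` and `r` and charge `p` against the bases `q, r` (second alternative, `Y = 0`, `Z = d`, `t = 2`:
`p² ∣ r^d − q⁰`, `q⁰ = 1 < r^d`): `p² ≤ C (pqr)^(1+ε) (r^d)^ε`.  With `q ≤ 5` and
`(pqr)^(1+ε) = p · p^ε · (qr)^(1+ε)` this reads `p ≤ L · p^ε` with
`L = C (qr)^(1+ε) r^(dε) ≤ C 5^(1+ε) r^(1+ε+dε)`, whence (`sqAbsorb_rpow`)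
`p ≤ L^{1/(1−ε)} ≤ (C 5^(1+ε))^{1/(1−ε)} · r^{(1+ε+dε)/(1−ε)} ≤ (C 5^(1+ε))^{1/(1−ε)} · r^(1+δ)`
(`sqFinal_le`).  (2) `r^5 − 1 = (r − 1) · Φ₅(r)` (`pow_five_sub_one`), so `p² ∣ Φ₅(r)` gives
`p² ∣ r^5 − 1` and (1) applies with `d = 5`.  (3) Compose with
`onePrimeTwoBase_of_uniformSadicTowerFour`.

**Context.** For `d ∈ {1, 2, 3, 4, 6}` the statement is trivial: `r^d − 1` factors into
`r ± 1`, `r² ± r + 1`, `r² + 1`, all of degree `≤ 2` and pairwise with bounded gcd, so every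
`p² ∣ r^d − 1` with `p` prime has `p ≤ r + 1`.  The first non-trivial exponent is `d = 5`:
`p² ∣ Φ₅(r)` allows `p` up to `≍ r²`, e.g. `11² ∣ Φ₅(3) = 121` — the abc triple `1 + 242 = 243`.
Unconditionally, "no square factor `p²` of `Φ₅(r)` with `p > r^(1+δ)`" is open; it follows from the
abc conjecture (squarefree values of polynomials: A. Granville, *ABC allows us to count squarefrees*,
IMRN 1998, building on Langevin).  So the theorems of this file are a HARDNESS CERTIFICATE for UPD(1,2),
and for the crux, on their ONE-LOGARITHM axis — complementary to the two-logarithm certificates of the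
line (prime-base Pillai with gap `2`, `…ThreeSlotPillai.lean`; Fermat–Catalan,
`…ThreeSlotFermatCatalan.lean`).

Sources: the crux notes of the line `flat-steep-split` (`Cruxes/UniformSadicTowerFour/`, lead c4); the
proofs are elementary real-analysis bookkeeping [folklore]; Granville (IMRN 1998) is context only, nothing
of it is used or vendored.  Mathlib only (`Nat.prime_two/three/five`, `Nat.one_lt_pow`, `Real.mul_rpow`,
`Real.rpow_add`, `Real.rpow_sub`, `Real.rpow_mul`, `Real.rpow_natCast`, `Real.rpow_le_rpow`,
`Real.rpow_le_rpow_of_exponent_le`, `div_le_iff₀`) plus the landed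
`onePrimeTwoBase_of_uniformSadicTowerFour`.  No new definitions.  Deliberately NOT here: UPD(1,2) itself
(OPEN, abc-type: it appears only as the explicit hypothesis `hU`), the unconditional square-divisor
bound for `Φ₅` (OPEN), and the other stubs of the line (other files).
-/

noncomputable section

-- `Summit.<Summit>.<Problem>` is the mandated summit-side namespace (CONVENTIONS §2); for the
-- single-conjunct summit `ABC` the two coincide, so the duplicate `ABC.ABC` is deliberate.
set_option linter.dupNamespace false

namespace Summit.ABC.ABC.Theorems.UniformSadicTowerFour.BoundedOmega

open Summit.ABC.ABC.Theses.IneffectiveSubspace (UniformSadicTowerFour)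
open scoped BigOperators

/-! ## Real-analysis bookkeeping: absorbing `p^ε` and the exponent `(1+ε+dε)/(1−ε) ≤ 1+δ` -/

/-- Absorption of a small power: if `c ≥ 1`, `θ < 1` and `c ≤ L · c^θ` in `ℝ`, then
`c ≤ L^{1/(1−θ)}` — divide by `c^θ > 0` to get `c^{1−θ} ≤ L` and raise both sides to the power
`1/(1−θ) > 0` (re-proved from the sibling file `…ThreeSlotOnePrime.lean`). [folklore] -/
private theorem sqAbsorb_rpow {c L θ : ℝ} (hc : 1 ≤ c) (hθ : θ < 1) (h : c ≤ L * c ^ θ) :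
    c ≤ L ^ (1 / (1 - θ)) := by
  have hc0 : 0 < c := one_pos.trans_le hc
  have h1θ : 0 < 1 - θ := sub_pos.2 hθ
  have h1 : c ^ (1 - θ) ≤ L := by
    rw [Real.rpow_sub hc0, Real.rpow_one, div_le_iff₀ (Real.rpow_pos_of_pos hc0 θ)]
    exact h
  calc c = (c ^ (1 - θ)) ^ (1 / (1 - θ)) := by
        rw [← Real.rpow_mul hc0.le, mul_one_div_cancel h1θ.ne', Real.rpow_one]
    _ ≤ L ^ (1 / (1 - θ)) :=
        Real.rpow_le_rpow (Real.rpow_nonneg hc0.le _) h1 (one_div_pos.2 h1θ).le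

/-- The real final step.  Let `0 < ε ≤ 1/2`, `δ > 0` with `ε · 2(d+2) ≤ δ`, `C > 0`, `P, R ≥ 1` and
`0 ≤ Q ≤ 5` in `ℝ` with `P² ≤ C · (PQR)^(1+ε) · (R^d)^ε`.  Since `(PQR)^(1+ε) = P · P^ε · (QR)^(1+ε)`
this reads `P ≤ L · P^ε` with `L = C (QR)^(1+ε) (R^d)^ε ≤ C 5^(1+ε) R^(1+ε+dε)`, so
(`sqAbsorb_rpow`) `P ≤ L^{1/(1−ε)} ≤ (C 5^(1+ε))^{1/(1−ε)} R^{(1+ε+dε)/(1−ε)}`, and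
`(1+ε+dε)/(1−ε) ≤ 1 + δ` because `2ε + dε + δε ≤ δ/2 + δ/2`, with `R ≥ 1`. [folklore] -/
private theorem sqFinal_le {ε δ C P Q R : ℝ} {d : ℕ} (hε : 0 < ε) (hε1 : ε ≤ 1 / 2) (hδ : 0 < δ)
    (hεd : ε * (2 * (d + 2)) ≤ δ) (hC : 0 < C) (hP : 1 ≤ P) (hR : 1 ≤ R) (hQ0 : 0 ≤ Q)
    (hQ : Q ≤ 5) (h : P ^ 2 ≤ C * (P * Q * R) ^ (1 + ε) * (R ^ d) ^ ε) :
    P ≤ (C * 5 ^ (1 + ε)) ^ (1 / (1 - ε)) * R ^ (1 + δ) := by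
  have hP0 : 0 < P := one_pos.trans_le hP
  have hR0 : 0 < R := one_pos.trans_le hR
  have hε' : ε < 1 := by linarith
  -- `(PQR)^(1+ε) = P · P^ε · (QR)^(1+ε)`
  have hsplit : (P * Q * R) ^ (1 + ε) = P * P ^ ε * (Q * R) ^ (1 + ε) := by
    rw [mul_assoc, Real.mul_rpow hP0.le (mul_nonneg hQ0 hR0.le), Real.rpow_add hP0, Real.rpow_one]
  -- `P ≤ L · P^ε` with `L = C (QR)^(1+ε) (R^d)^ε`, and absorption
  have hL0 : 0 ≤ C * (Q * R) ^ (1 + ε) * (R ^ d) ^ ε := by positivity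
  have h1 : P ≤ C * (Q * R) ^ (1 + ε) * (R ^ d) ^ ε * P ^ ε := by
    refine le_of_mul_le_mul_left ?_ hP0
    calc P * P = P ^ 2 := (sq P).symm
      _ ≤ C * (P * Q * R) ^ (1 + ε) * (R ^ d) ^ ε := h
      _ = P * (C * (Q * R) ^ (1 + ε) * (R ^ d) ^ ε * P ^ ε) := by rw [hsplit]; ring
  have h2 : P ≤ (C * (Q * R) ^ (1 + ε) * (R ^ d) ^ ε) ^ (1 / (1 - ε)) := sqAbsorb_rpow hP hε' h1
  -- `L ≤ C · 5^(1+ε) · R^(1+ε+dε)`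
  have hQR : (Q * R) ^ (1 + ε) ≤ 5 ^ (1 + ε) * R ^ (1 + ε) := by
    rw [← Real.mul_rpow (by norm_num) hR0.le]
    exact Real.rpow_le_rpow (mul_nonneg hQ0 hR0.le) (mul_le_mul_of_nonneg_right hQ hR0.le)
      (by linarith)
  have hRd : (R ^ d) ^ ε = R ^ ((d : ℝ) * ε) := by
    rw [← Real.rpow_natCast R d, ← Real.rpow_mul hR0.le]
  have hLle : C * (Q * R) ^ (1 + ε) * (R ^ d) ^ ε ≤ C * 5 ^ (1 + ε) * R ^ (1 + ε + d * ε) :=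
    calc C * (Q * R) ^ (1 + ε) * (R ^ d) ^ ε ≤ C * (5 ^ (1 + ε) * R ^ (1 + ε)) * (R ^ d) ^ ε :=
          mul_le_mul_of_nonneg_right (mul_le_mul_of_nonneg_left hQR hC.le) (by positivity)
      _ = C * 5 ^ (1 + ε) * R ^ (1 + ε + d * ε) := by
          rw [hRd, Real.rpow_add hR0 (1 + ε) (d * ε)]; ring
  -- the exponent `(1+ε+dε)/(1−ε) ≤ 1+δ`
  have hεδ : ε * δ ≤ 1 / 2 * δ := mul_le_mul_of_nonneg_right hε1 hδ.le
  have hexp : (1 + ε + d * ε) * (1 / (1 - ε)) ≤ 1 + δ := by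
    rw [mul_one_div, div_le_iff₀ (by linarith : (0 : ℝ) < 1 - ε)]
    nlinarith
  have h3 : (C * 5 ^ (1 + ε) * R ^ (1 + ε + d * ε)) ^ (1 / (1 - ε)) ≤
      (C * 5 ^ (1 + ε)) ^ (1 / (1 - ε)) * R ^ (1 + δ) := by
    rw [Real.mul_rpow (by positivity) (by positivity), ← Real.rpow_mul hR0.le]
    exact mul_le_mul_of_nonneg_left (Real.rpow_le_rpow_of_exponent_le hR hexp) (by positivity)
  exact h2.trans ((Real.rpow_le_rpow hL0 hLle (one_div_pos.2 (by linarith)).le).trans h3)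

/-! ## The arithmetic: an auxiliary prime and the factorisation `r⁵ − 1 = (r − 1) Φ₅(r)` -/

/-- Among the three primes `2, 3, 5` at least one is distinct from any two given naturals `p, r`:
an auxiliary prime `q ≤ 5` with `q ≠ p`, `q ≠ r`. [folklore] -/
private theorem exists_aux_prime (p r : ℕ) : ∃ q : ℕ, q.Prime ∧ p ≠ q ∧ q ≠ r ∧ q ≤ 5 := by
  by_cases h2 : p = 2 ∨ r = 2
  · by_cases h3 : p = 3 ∨ r = 3
    · exact ⟨5, Nat.prime_five, by omega, by omega, le_rfl⟩
    · exact ⟨3, Nat.prime_three, by omega, by omega, by norm_num⟩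
  · exact ⟨2, Nat.prime_two, by omega, by omega, by norm_num⟩

/-- The cyclotomic factorisation `r⁵ − 1 = (r − 1) · (r⁴ + r³ + r² + r + 1)` in `ℕ` (truncated
subtraction; at `r = 0` both sides vanish). [folklore] -/
private theorem pow_five_sub_one (r : ℕ) :
    r ^ 5 - 1 = (r - 1) * (r ^ 4 + r ^ 3 + r ^ 2 + r + 1) := by
  rcases r with _ | r
  · simp
  · have h : (r + 1) ^ 5 =
        r * ((r + 1) ^ 4 + (r + 1) ^ 3 + (r + 1) ^ 2 + (r + 1) + 1) + 1 := by ring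
    rw [h, Nat.add_sub_cancel, Nat.add_sub_cancel]

/-! ## The theorems -/

/-- **UPD(1,2) ⟹ square prime divisors of `r^d − 1` are small.** For every fixed `d ≥ 1` and
`δ > 0` there is `C` with `p ≤ C · r^(1+δ)` whenever `p ≠ r` are primes and `p² ∣ r^d − 1`.
Proof: with `ε = min(1/2, δ/(2(d+2)))` and the constant `C(ε)` of UPD, charge `p` against the bases
`q, r` for an auxiliary prime `q ∈ {2, 3, 5}` (`exists_aux_prime`; second alternative, `Y = 0`,
`Z = d`, `t = 2`): `p² ≤ C (pqr)^(1+ε) (r^d)^ε`, absorbed by `sqFinal_le` into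
`p ≤ (C 5^(1+ε))^{1/(1−ε)} · r^(1+δ)`. [folklore] -/
theorem squareDivisor_pow_sub_one_of_onePrimeTwoBase
    (hU : ∀ ε : ℝ, 0 < ε → ∃ C : ℝ, 0 < C ∧ ∀ p q r : ℕ, p.Prime → q.Prime → r.Prime →
      p ≠ q → p ≠ r → q ≠ r → ∀ Y Z t : ℕ,
      (p ^ t ∣ q ^ Y * r ^ Z - 1 ∧ 2 ≤ q ^ Y * r ^ Z) ∨ (p ^ t ∣ r ^ Z - q ^ Y ∧ q ^ Y < r ^ Z) →
      ((p ^ t : ℕ) : ℝ) ≤ C * ((p * q * r : ℕ) : ℝ) ^ (1 + ε) * ((q ^ Y * r ^ Z : ℕ) : ℝ) ^ ε)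
    {d : ℕ} (hd : 1 ≤ d) : ∀ δ : ℝ, 0 < δ → ∃ C : ℝ, 0 < C ∧ ∀ p r : ℕ, p.Prime → r.Prime → p ≠ r →
      p ^ 2 ∣ r ^ d - 1 → (p : ℝ) ≤ C * (r : ℝ) ^ (1 + δ) := by
  intro δ hδ
  -- the auxiliary exponent `ε = min(1/2, δ/(2(d+2)))`
  obtain ⟨ε, hε0, hε1, hεd⟩ : ∃ ε : ℝ, 0 < ε ∧ ε ≤ 1 / 2 ∧ ε * (2 * (d + 2)) ≤ δ :=
    ⟨min (1 / 2) (δ / (2 * (d + 2))), lt_min (by norm_num) (by positivity), min_le_left _ _,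
      (le_div_iff₀ (by positivity)).1 (min_le_right _ _)⟩
  obtain ⟨C, hC, H⟩ := hU ε hε0
  refine ⟨(C * 5 ^ (1 + ε)) ^ (1 / (1 - ε)), Real.rpow_pos_of_pos (by positivity) _, ?_⟩
  intro p r hp hr hpr hdvd
  -- an auxiliary prime `q ∈ {2, 3, 5}` and the charge of `p` against `q, r`
  obtain ⟨q, hq, hpq, hqr, hq5⟩ := exists_aux_prime p r
  have hlt : q ^ 0 < r ^ d := by
    rw [pow_zero]
    exact Nat.one_lt_pow (by omega) hr.one_lt
  have key := H p q r hp hq hr hpq hpr hqr 0 d 2 (Or.inr ⟨by rwa [pow_zero], hlt⟩)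
  simp only [pow_zero, one_mul, Nat.cast_pow, Nat.cast_mul] at key
  have hP : (1 : ℝ) ≤ p := by exact_mod_cast hp.one_lt.le
  have hR : (1 : ℝ) ≤ r := by exact_mod_cast hr.one_lt.le
  have hQ : (q : ℝ) ≤ 5 := by exact_mod_cast hq5
  exact sqFinal_le hε0 hε1 hδ hεd hC hP hR (Nat.cast_nonneg q) hQ key

/-- **UPD(1,2) ⟹ square prime divisors of `Φ₅(r)` are small.** Large square divisors of the
cyclotomic value `Φ₅(r) = r⁴ + r³ + r² + r + 1` at a prime `r` are small:
`p² ∣ Φ₅(r) ⟹ p ≤ C_δ · r^(1+δ)` for primes `p ≠ r` (the first exponent `d = 5` for which this is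
not trivial).  Proof: `Φ₅(r) ∣ r⁵ − 1` (`pow_five_sub_one`) and
`squareDivisor_pow_sub_one_of_onePrimeTwoBase` with `d = 5`. [folklore] -/
theorem squareDivisor_cyclotomicFive_of_onePrimeTwoBase
    (hU : ∀ ε : ℝ, 0 < ε → ∃ C : ℝ, 0 < C ∧ ∀ p q r : ℕ, p.Prime → q.Prime → r.Prime →
      p ≠ q → p ≠ r → q ≠ r → ∀ Y Z t : ℕ,
      (p ^ t ∣ q ^ Y * r ^ Z - 1 ∧ 2 ≤ q ^ Y * r ^ Z) ∨ (p ^ t ∣ r ^ Z - q ^ Y ∧ q ^ Y < r ^ Z) →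
      ((p ^ t : ℕ) : ℝ) ≤ C * ((p * q * r : ℕ) : ℝ) ^ (1 + ε) * ((q ^ Y * r ^ Z : ℕ) : ℝ) ^ ε) :
    ∀ δ : ℝ, 0 < δ → ∃ C : ℝ, 0 < C ∧ ∀ p r : ℕ, p.Prime → r.Prime → p ≠ r →
      p ^ 2 ∣ r ^ 4 + r ^ 3 + r ^ 2 + r + 1 → (p : ℝ) ≤ C * (r : ℝ) ^ (1 + δ) := by
  intro δ hδ
  obtain ⟨C, hC, H⟩ :=
    squareDivisor_pow_sub_one_of_onePrimeTwoBase hU (d := 5) (by norm_num) δ hδ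
  refine ⟨C, hC, fun p r hp hr hpr hdvd => H p r hp hr hpr ?_⟩
  rw [pow_five_sub_one]
  exact Dvd.dvd.mul_left hdvd _

/-- **The crux ⟹ square prime divisors of `Φ₅(r)` are small** (abc-type necessary condition: "no
large square factors of cyclotomic values"): `UniformSadicTowerFour` implies, for every `δ > 0`, a
constant `C` with `p ≤ C · r^(1+δ)` whenever `p ≠ r` are primes and `p² ∣ r⁴ + r³ + r² + r + 1` —
through UPD(1,2) (`onePrimeTwoBase_of_uniformSadicTowerFour`) and
`squareDivisor_cyclotomicFive_of_onePrimeTwoBase`. [folklore] -/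
theorem squareDivisor_cyclotomicFive_of_uniformSadicTowerFour (hU : UniformSadicTowerFour) :
    ∀ δ : ℝ, 0 < δ → ∃ C : ℝ, 0 < C ∧ ∀ p r : ℕ, p.Prime → r.Prime → p ≠ r →
      p ^ 2 ∣ r ^ 4 + r ^ 3 + r ^ 2 + r + 1 → (p : ℝ) ≤ C * (r : ℝ) ^ (1 + δ) :=
  squareDivisor_cyclotomicFive_of_onePrimeTwoBase (onePrimeTwoBase_of_uniformSadicTowerFour hU)

end Summit.ABC.ABC.Theorems.UniformSadicTowerFour.BoundedOmega

end
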